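import Mathlib
import Summits.ValiantsHypothesis.ValiantsHypothesis.Theorems.NewtonUnitEquationsDissociatedUniformTotalsLaw
import Summits.ValiantsHypothesis.ValiantsHypothesis.Theorems.NewtonUnitEquationsDissociatedUniformTotalsLawConstant
import Summits.ValiantsHypothesis.ValiantsHypothesis.Theorems.NewtonUnitEquationsDissociatedUniformTotalsLawUnion
import Literature.Computability.AlgebraicComplexity.NewtonPolygonTauProductBounds
import HarnessLib

/-!
# Crux `NewtonUnitEquations.DissociatedUniform` (stmt-ValiantsHypothesis-5905): the union-of-fibres totals law — the additive COSET stratum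

Companion of `…DissociatedUniformTotalsLawUnion` (`unionPts a b Z s = U_s(Z) = ⋃_{z∈Z} P_{s-z}`, `unionVert`, `unionTotal`,
`@[conjecture] UnionTotalsLaw C : ∑_s #vert conv U_s(Z) ≤ C·|G|²`, OPEN).  Here: the position sets with SUBGROUP structure are
exactly as additive as `Z = univ`.

* `unionVert_coset_le`: if `Z = g + H` is a coset of a subgroup `H ≤ G` then
  `U_s(Z) = ⋃_{X ∈ G/H} (a(X) + b((s - g) - X))` is a union of `[G:H]` Minkowski sums of two `|H|`-sets, hence
  `#vert conv U_s(Z) ≤ ∑_X (|H| + |H|) = 2|G|` for EVERY class `s` (planar Minkowski bound of the tree,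
  `KPTT.PlanarMinkowski.ncard_extremePoints_add_le`, and "a vertex of a union is a vertex of its part"); so
  `unionTotal a b Z ≤ 2|G|²` (`unionTotal_coset_le`): the union totals law holds with its sharp constant `C = 2` on cosets.
* `unionVert_cosets_le` / `unionTotal_cosets_le`: a union of `|R|` cosets has `#vert conv U_s(Z) ≤ 2|R|·|G|`, total `≤ 2|R|·|G|²`;
  symmetries `unionTotal_comp_addEquiv` (relabelling by `φ : G ≃+ G` maps `Z` to `φ(Z)`) and `unionTotal_vadd_positions`
  (translating `Z` changes nothing).
* `classVert_le_of_const_on_cosets` / `totalVert_le_of_const_on_cosets`: a third curve `c` constant on the cosets of `H`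
  (i.e. factoring through `G/H`) has `V_s ≤ 2|G|·[G:H]` and `T ≤ 2[G:H]·|G|²` — index `1` is the constant stratum
  (`…TotalsLaw.totalVert_const_le`), and the `n = 3` law `T ≤ C|G|²` holds on every stratum of bounded index.
Honest label: an additive stratum only; `UnionTotalsLaw` / `TotalsLawThree` remain OPEN; nothing here bears on VP ≠ VNP.
[folklore]
-/

set_option linter.dupNamespace false -- `ValiantsHypothesis.ValiantsHypothesis` (summit = problem) in every name

open scoped BigOperators Pointwise

namespace Summit.ValiantsHypothesis.ValiantsHypothesis.Theorems.NewtonUnitEquationsDissociatedUniform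

namespace TotalsLaw

open Literature.Computability.AlgebraicComplexity.KPTT.PlanarMinkowski

variable {G : Type*} [AddCommGroup G] [Fintype G]

/-! ### The additive stratum: cosets of a subgroup -/

/-- **Coset position sets are additive.**  If `Z = g + H` is a coset of a subgroup `H ≤ G` then
`U_s(Z) = ⋃_{X ∈ G/H} (a(X) + b((s - g) - X))` is a union of `[G:H]` Minkowski sums of two `|H|`-sets, so
`#vert conv U_s(Z) ≤ ∑_X (|H| + |H|) = 2|G|`. [folklore] -/
theorem unionVert_coset_le (a b : G → (Fin 2 → ℝ)) (H : AddSubgroup G) (g s : G) :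
    unionVert a b {z | z - g ∈ H} s ≤ 2 * Fintype.card G := by
  classical
  set A : G ⧸ H → Finset (Fin 2 → ℝ) := fun X => (Finset.univ.filter fun x : G => (x : G ⧸ H) = X).image a with hA
  set B : G ⧸ H → Finset (Fin 2 → ℝ) :=
    fun X => (Finset.univ.filter fun y : G => ((s - g - y : G) : G ⧸ H) = X).image b with hB
  have hU : unionPts a b {z | z - g ∈ H} s =
      (((Finset.univ : Finset (G ⧸ H)).biUnion fun X => A X + B X : Finset (Fin 2 → ℝ)) : Set (Fin 2 → ℝ)) := by
    ext p
    rw [mem_unionPts, Finset.coe_biUnion]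
    simp only [Finset.coe_univ, Set.mem_univ, Set.iUnion_true, Set.mem_iUnion, Finset.coe_add, Set.mem_add,
      Finset.mem_coe, hA, hB, Finset.mem_image, Finset.mem_filter, Finset.mem_univ, true_and, Set.mem_setOf_eq]
    constructor
    · rintro ⟨x, y, hxy, rfl⟩
      refine ⟨(x : G ⧸ H), a x, ⟨x, rfl, rfl⟩, b y, ⟨y, ?_, rfl⟩, rfl⟩
      rw [QuotientAddGroup.eq]
      have : -(s - g - y) + x = -(s - x - y - g) := by abel
      rw [this]
      exact H.neg_mem hxy
    · rintro ⟨X, _, ⟨x, hx, rfl⟩, _, ⟨y, hy, rfl⟩, rfl⟩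
      refine ⟨x, y, ?_, rfl⟩
      have hxy : ((s - g - y : G) : G ⧸ H) = (x : G ⧸ H) := hy.trans hx.symm
      rw [QuotientAddGroup.eq] at hxy
      have : s - x - y - g = -(-(s - g - y) + x) := by abel
      rw [this]
      exact H.neg_mem hxy
  have hAne : ∀ X, (A X).Nonempty := by
    intro X
    induction X using QuotientAddGroup.induction_on with
    | H x => exact ⟨a x, Finset.mem_image.2 ⟨x, by simp, rfl⟩⟩
  have hBne : ∀ X, (B X).Nonempty := by
    intro X
    induction X using QuotientAddGroup.induction_on with
    | H x =>
      refine ⟨b (s - g - x), Finset.mem_image.2 ⟨s - g - x, ?_, rfl⟩⟩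
      simp only [Finset.mem_filter, Finset.mem_univ, true_and]
      rw [show s - g - (s - g - x) = x by abel]
  have hAsum : ∑ X, (A X).card ≤ Fintype.card G := by
    calc ∑ X, (A X).card ≤ ∑ X, (Finset.univ.filter fun x : G => (x : G ⧸ H) = X).card :=
          Finset.sum_le_sum fun X _ => Finset.card_image_le
      _ = (Finset.univ : Finset G).card :=
          (Finset.card_eq_sum_card_fiberwise fun x _ => Finset.mem_univ ((x : G) : G ⧸ H)).symm
      _ = Fintype.card G := Finset.card_univ
  have hBsum : ∑ X, (B X).card ≤ Fintype.card G := by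
    calc ∑ X, (B X).card ≤ ∑ X, (Finset.univ.filter fun y : G => ((s - g - y : G) : G ⧸ H) = X).card :=
          Finset.sum_le_sum fun X _ => Finset.card_image_le
      _ = (Finset.univ : Finset G).card :=
          (Finset.card_eq_sum_card_fiberwise fun y _ => Finset.mem_univ ((s - g - y : G) : G ⧸ H)).symm
      _ = Fintype.card G := Finset.card_univ
  unfold unionVert
  rw [hU]
  refine (ncard_extremePoints_biUnion_le _ _).trans ?_
  calc ∑ X, ((convexHull ℝ ((A X + B X : Finset (Fin 2 → ℝ)) : Set (Fin 2 → ℝ))).extremePoints ℝ).ncard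
      ≤ ∑ X, ((A X).card + (B X).card) := Finset.sum_le_sum fun X _ =>
        (ncard_extremePoints_add_le (hAne X) (hBne X)).trans
          (add_le_add (ncard_extremePoints_le_card _) (ncard_extremePoints_le_card _))
    _ = ∑ X, (A X).card + ∑ X, (B X).card := Finset.sum_add_distrib
    _ ≤ Fintype.card G + Fintype.card G := add_le_add hAsum hBsum
    _ = 2 * Fintype.card G := (two_mul _).symm

/-- Hence coset position sets satisfy the union totals law with `C = 2`: `unionTotal ≤ 2|G|²`. [folklore] -/
theorem unionTotal_coset_le (a b : G → (Fin 2 → ℝ)) (H : AddSubgroup G) (g : G) :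
    unionTotal a b {z | z - g ∈ H} ≤ 2 * Fintype.card G ^ 2 := by
  unfold unionTotal
  calc ∑ s, unionVert a b {z | z - g ∈ H} s ≤ ∑ _s : G, 2 * Fintype.card G :=
        Finset.sum_le_sum fun s _ => unionVert_coset_le a b H g s
    _ = 2 * Fintype.card G ^ 2 := by rw [Finset.sum_const, Finset.card_univ, smul_eq_mul]; ring


/-- **Unions of cosets.**  If `Z = ⋃_{g ∈ R} (g + H)` is a union of `|R|` cosets of `H` then `#vert conv U_s(Z) ≤ 2|R|·|G|`
(fibre unions of a union of position sets are unions of fibre unions). [folklore] -/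
theorem unionVert_cosets_le (a b : G → (Fin 2 → ℝ)) (H : AddSubgroup G) (R : Finset G) (s : G) :
    unionVert a b (⋃ g ∈ R, {z | z - g ∈ H}) s ≤ 2 * R.card * Fintype.card G := by
  classical
  set F : G → Finset (Fin 2 → ℝ) := fun g => (unionPts_finite a b {z | z - g ∈ H} s).toFinset with hF
  have hFcoe : ∀ g, (F g : Set (Fin 2 → ℝ)) = unionPts a b {z | z - g ∈ H} s := fun g => by
    rw [hF, Set.Finite.coe_toFinset]
  have hU : unionPts a b (⋃ g ∈ R, {z | z - g ∈ H}) s = ((R.biUnion F : Finset (Fin 2 → ℝ)) : Set (Fin 2 → ℝ)) := by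
    ext p
    rw [Finset.coe_biUnion]
    simp only [mem_unionPts, Set.mem_iUnion, Set.mem_setOf_eq, exists_prop, Finset.mem_coe, hFcoe]
    constructor
    · rintro ⟨x, y, ⟨g, hg, hxy⟩, rfl⟩
      exact ⟨g, hg, x, y, hxy, rfl⟩
    · rintro ⟨g, hg, x, y, hxy, rfl⟩
      exact ⟨x, y, ⟨g, hg, hxy⟩, rfl⟩
  unfold unionVert
  rw [hU]
  refine (ncard_extremePoints_biUnion_le R F).trans ?_
  calc ∑ g ∈ R, ((convexHull ℝ (F g : Set (Fin 2 → ℝ))).extremePoints ℝ).ncard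
      ≤ ∑ _g ∈ R, 2 * Fintype.card G := Finset.sum_le_sum fun g _ => by
        rw [hFcoe g]
        exact unionVert_coset_le a b H g s
    _ = 2 * R.card * Fintype.card G := by rw [Finset.sum_const, smul_eq_mul]; ring

/-- Hence the union totals law with constant `2|R|` for unions of `|R|` cosets (of any subgroup). [folklore] -/
theorem unionTotal_cosets_le (a b : G → (Fin 2 → ℝ)) (H : AddSubgroup G) (R : Finset G) :
    unionTotal a b (⋃ g ∈ R, {z | z - g ∈ H}) ≤ 2 * R.card * Fintype.card G ^ 2 := by
  unfold unionTotal
  calc ∑ s, unionVert a b (⋃ g ∈ R, {z | z - g ∈ H}) s ≤ ∑ _s : G, 2 * R.card * Fintype.card G :=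
        Finset.sum_le_sum fun s _ => unionVert_cosets_le a b H R s
    _ = 2 * R.card * Fintype.card G ^ 2 := by rw [Finset.sum_const, Finset.card_univ, smul_eq_mul]; ring

/-! ### Symmetries of union totals (relabelling by automorphisms, translating the positions) -/

omit [Fintype G] in
/-- Relabelling both letter curves by an automorphism `φ` of `G`: `U_s(Z)[a ∘ φ, b ∘ φ] = U_{φ s}(φ(Z))[a, b]`
(so, e.g., arithmetic progressions of unit step in `ZMod q` are as good as intervals). [folklore] -/
theorem unionPts_comp_addEquiv (a b : G → (Fin 2 → ℝ)) (φ : G ≃+ G) (Z : Set G) (s : G) :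
    unionPts (a ∘ φ) (b ∘ φ) Z s = unionPts a b (φ '' Z) (φ s) := by
  ext p
  simp only [mem_unionPts, Function.comp_apply, Set.mem_image]
  constructor
  · rintro ⟨x, y, hxy, rfl⟩
    exact ⟨φ x, φ y, ⟨s - x - y, hxy, by rw [map_sub, map_sub]⟩, rfl⟩
  · rintro ⟨x, y, ⟨z, hz, hzxy⟩, rfl⟩
    refine ⟨φ.symm x, φ.symm y, ?_, by rw [φ.apply_symm_apply, φ.apply_symm_apply]⟩
    have h : s - φ.symm x - φ.symm y = z := by
      apply φ.injective
      rw [map_sub, map_sub, φ.apply_symm_apply, φ.apply_symm_apply, hzxy]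
    rw [h]
    exact hz

omit [Fintype G] in
/-- Vertex counts under relabelling by an automorphism. [folklore] -/
theorem unionVert_comp_addEquiv (a b : G → (Fin 2 → ℝ)) (φ : G ≃+ G) (Z : Set G) (s : G) :
    unionVert (a ∘ φ) (b ∘ φ) Z s = unionVert a b (φ '' Z) (φ s) := by
  unfold unionVert
  rw [unionPts_comp_addEquiv]

/-- **Union totals are invariant under relabelling by automorphisms**: `unionTotal (a∘φ) (b∘φ) Z = unionTotal a b φ(Z)`.
[folklore] -/
theorem unionTotal_comp_addEquiv (a b : G → (Fin 2 → ℝ)) (φ : G ≃+ G) (Z : Set G) :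
    unionTotal (a ∘ φ) (b ∘ φ) Z = unionTotal a b (φ '' Z) := by
  unfold unionTotal
  simp_rw [unionVert_comp_addEquiv]
  exact Fintype.sum_equiv φ.toEquiv _ _ fun s => rfl

omit [Fintype G] in
/-- Translating the position set translates the class index: `U_s(g + Z) = U_{s-g}(Z)`. [folklore] -/
theorem unionPts_vadd_positions (a b : G → (Fin 2 → ℝ)) (Z : Set G) (g s : G) :
    unionPts a b ((fun z => g + z) '' Z) s = unionPts a b Z (s - g) := by
  ext p
  simp only [mem_unionPts, Set.mem_image]
  constructor
  · rintro ⟨x, y, ⟨z, hz, hzg⟩, rfl⟩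
    refine ⟨x, y, ?_, rfl⟩
    have h : s - g - x - y = z := by
      rw [show s - g - x - y = (s - x - y) - g by abel, ← hzg]
      abel
    rw [h]
    exact hz
  · rintro ⟨x, y, hxy, rfl⟩
    exact ⟨x, y, ⟨s - g - x - y, hxy, by abel⟩, rfl⟩

/-- **Union totals are invariant under translating the position set.** [folklore] -/
theorem unionTotal_vadd_positions (a b : G → (Fin 2 → ℝ)) (Z : Set G) (g : G) :
    unionTotal a b ((fun z => g + z) '' Z) = unionTotal a b Z := by
  unfold unionTotal unionVert
  simp_rw [unionPts_vadd_positions]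
  exact Fintype.sum_equiv (Equiv.subRight g) _ _ fun s => rfl

/-! ### Third curves constant on cosets -/

/-- **A third curve constant on the cosets of `H` has `V_s ≤ 2|G|·[G:H]`** (index `1`: the constant stratum `V_s ≤ 2|G|`).
The class is the union over `X ∈ G/H` of the translates `c(X) + U_s(X)`, and each coset union has `≤ 2|G|` vertices
(`unionVert_coset_le`). [folklore] -/
theorem classVert_le_of_const_on_cosets (a b c : G → (Fin 2 → ℝ)) (H : AddSubgroup G)
    (hc : ∀ z w : G, z - w ∈ H → c z = c w) (s : G) :
    classVert a b c s ≤ 2 * Fintype.card G * H.index := by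
  classical
  have hindex : H.index = Fintype.card (G ⧸ H) := by
    rw [AddSubgroup.index, Nat.card_eq_fintype_card]
  -- a representative of each coset
  set ρ : G ⧸ H → G := fun X => Quotient.out X with hρ
  have hρmk : ∀ X : G ⧸ H, ((ρ X : G) : G ⧸ H) = X := fun X => Quotient.out_eq X
  have hmem : ∀ z : G, z - ρ (z : G ⧸ H) ∈ H := by
    intro z
    have h1 : ((ρ (z : G ⧸ H) : G) : G ⧸ H) = (z : G ⧸ H) := hρmk _
    rw [QuotientAddGroup.eq] at h1
    have : z - ρ (z : G ⧸ H) = -ρ (z : G ⧸ H) + z := by abel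
    rw [this]
    exact h1
  set F : G ⧸ H → Finset (Fin 2 → ℝ) :=
    fun X => (unionPts_finite a b {z | z - ρ X ∈ H} s).toFinset.image fun p => c (ρ X) +ᵥ p with hF
  have hFcoe : ∀ X, (F X : Set (Fin 2 → ℝ)) = c (ρ X) +ᵥ unionPts a b {z | z - ρ X ∈ H} s := by
    intro X
    rw [hF, Finset.coe_image, Set.Finite.coe_toFinset, Set.image_vadd]
  have hclass : classPts a b c s = (((Finset.univ : Finset (G ⧸ H)).biUnion F : Finset (Fin 2 → ℝ)) : Set (Fin 2 → ℝ)) := by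
    ext p
    rw [Finset.coe_biUnion]
    simp only [Finset.coe_univ, Set.mem_univ, Set.iUnion_true, Set.mem_iUnion, hFcoe, Set.mem_vadd_set, mem_unionPts,
      Set.mem_setOf_eq, vadd_eq_add, classPts, Set.mem_range, Prod.exists]
    constructor
    · rintro ⟨x, y, rfl⟩
      refine ⟨((s - x - y : G) : G ⧸ H), a x + b y, ⟨x, y, hmem _, rfl⟩, ?_⟩
      rw [hc (ρ ((s - x - y : G) : G ⧸ H)) (s - x - y)]
      · abel
      · have h := H.neg_mem (hmem (s - x - y))
        rwa [neg_sub] at h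
    · rintro ⟨X, q, ⟨x, y, hxy, rfl⟩, rfl⟩
      refine ⟨x, y, ?_⟩
      rw [hc (s - x - y) (ρ X) hxy]
      abel
  unfold classVert
  rw [hclass]
  refine (ncard_extremePoints_biUnion_le _ F).trans ?_
  calc ∑ X, ((convexHull ℝ (F X : Set (Fin 2 → ℝ))).extremePoints ℝ).ncard
      ≤ ∑ _X : G ⧸ H, 2 * Fintype.card G := Finset.sum_le_sum fun X _ => by
        rw [hFcoe X, ncard_extremePoints_vadd]
        exact unionVert_coset_le a b H (ρ X) s
    _ = 2 * Fintype.card G * H.index := by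
        rw [Finset.sum_const, Finset.card_univ, smul_eq_mul, hindex]; ring

/-- Hence `T ≤ 2·[G:H]·|G|²` for third curves constant on the cosets of `H` — the coset strata are additive with the index
as the constant. [folklore] -/
theorem totalVert_le_of_const_on_cosets (a b c : G → (Fin 2 → ℝ)) (H : AddSubgroup G)
    (hc : ∀ z w : G, z - w ∈ H → c z = c w) :
    totalVert a b c ≤ 2 * H.index * Fintype.card G ^ 2 := by
  unfold totalVert
  calc ∑ s, classVert a b c s ≤ ∑ _s : G, 2 * Fintype.card G * H.index :=
        Finset.sum_le_sum fun s _ => classVert_le_of_const_on_cosets a b c H hc s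
    _ = 2 * H.index * Fintype.card G ^ 2 := by
        rw [Finset.sum_const, Finset.card_univ, smul_eq_mul]; ring

end TotalsLaw

end Summit.ValiantsHypothesis.ValiantsHypothesis.Theorems.NewtonUnitEquationsDissociatedUniform
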